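import Summits.Ventures.Crystal3D.Theorems.StickyWulffConstantGenericWallFloorCredits
import HarnessLib

/-!
# Packing-extension credits: ADDABLE empty sites make their contacts pay
# (crux `GenericWallFloor`, stmt-Ventures-19480, line `WallLedgerG`; also usable by line `WallLedgerF`)

HONEST FRAMING. Venture `Summits/Ventures/Crystal3D` (cell `crystal3d-full`), helper `--supports` the crux
`GenericWallFloor` of `route-Ventures-StickyWulffConstant`, REGISTERED line `WallLedgerG`, open stub
`stub_twoSlabAdhesion`.  Rung credit only; F-C1 not moved; NOT the crux.  CENSUS-FREE, standard axioms; the only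
input is the kissing number of `ℝ³` (`card_filter_dist_eq_one_le_twelve`, from `musin2006_kissing_three_holds`).

WHY (memo RISER-LEDGER-g8 on the item, §3–§4).  Every walker-END certificate of the lane (`…StackLedger*`) credits ONE
missing contact per distinct end ball, and a per-ball certificate anchored on walker-visible data (unions of closed
backward stars + «not full») can never credit more: the single-vacancy completion (eleven exact slots, one empty site,
`fcc_single_vacancy`) is always consistent with that data and has degree `11`.  On the residual cap of lane G the ideal
terrace/riser competitor offers `14` missing contacts per unit riser length per 3-plane step and interface, of which a
`c₀ = 1` certificate needs `4.24`, while the in-plane walker ends of the far grain occupy only `3` distinct balls there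
(degrees `9`, `10`, `11`) — so the lane needs credits that are NOT «one per end ball».  This file supplies the simplest
census-free multi-credit device, the one that prices the vacancy branch of every riser row exactly:

* `card_contacts_add_card_extContacts_le_twelve` — if `X ∪ V` is `1`-separated (`V` = extra, ADDABLE sites, disjoint
  from `X`), then at every point `y` the contacts of `y` in `X` plus the contacts of `y` in `V` number at most `12`;
* `sum_extContacts_le_sum_twelve_sub` — summed over any `S ⊆ X`: `Σ_{y∈S} #{v ∈ V : dist y v = 1} ≤ Σ_{y∈S} (12 − deg_X y)`,
  i.e. the ledger currency of `ledger_ge_faces_add_interior_credits` is bounded BELOW by the number of ball–site contacts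
  of ANY packing extension `V` — an exact vacancy with its twelve lattice neighbours present is worth `12` credits
  (its true price), not the `1` per neighbour that end-counting sees;
* `sum_extContacts_eq_sum_card_contacts` — the same count read from the sites: `Σ_{v∈V} #{y ∈ S : dist v y = 1}`;
* `card_contacts_le_eleven_of_addable`, `card_contacts_le_ten_of_two_addable` — one addable site adjacent to `y` forces
  `deg y ≤ 11`, two addable sites at mutual distance `≥ 1` force `deg y ≤ 10`.

WHAT THIS IS NOT: no ledger, no row, no statement about which sites are addable in a wall cell; F-C1 not moved.
-/

noncomputable section

namespace Summit.Ventures.Crystal3D.Theorems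

open Finset

/-- **Contacts in `X` plus contacts among the extra sites `V` are at most twelve.**  `X`, `V` disjoint finite sets with
`X ∪ V` `1`-separated; then for every point `y`,
`#{q ∈ X : dist y q = 1} + #{v ∈ V : dist y v = 1} ≤ 12` (the kissing number, applied to `X ∪ V`). -/
theorem card_contacts_add_card_extContacts_le_twelve (X V : Finset (EuclideanSpace ℝ (Fin 3)))
    (hsep : ∀ p ∈ X ∪ V, ∀ q ∈ X ∪ V, p ≠ q → 1 ≤ dist p q) (hdisj : Disjoint X V)
    (y : EuclideanSpace ℝ (Fin 3)) :
    (X.filter fun q => dist y q = 1).card + (V.filter fun q => dist y q = 1).card ≤ 12 := by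
  classical
  have h := card_filter_dist_eq_one_le_twelve (X ∪ V) hsep y
  rwa [filter_union, card_union_of_disjoint (disjoint_filter_filter hdisj)] at h

/-- **Packing-extension credits, summed.**  For any finite `S` (typically `S ⊆ X`) and a packing extension `V` of `X`
(disjoint, `X ∪ V` `1`-separated): `Σ_{y ∈ S} #{v ∈ V : dist y v = 1} ≤ Σ_{y ∈ S} (12 − deg_X y)` in the real-valued ledger currency. -/
theorem sum_extContacts_le_sum_twelve_sub (X V S : Finset (EuclideanSpace ℝ (Fin 3)))
    (hsep : ∀ p ∈ X ∪ V, ∀ q ∈ X ∪ V, p ≠ q → 1 ≤ dist p q) (hdisj : Disjoint X V) :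
    (∑ y ∈ S, ((V.filter fun q => dist y q = 1).card : ℝ)) ≤
      ∑ y ∈ S, ((12 : ℝ) - ((X.filter fun q => dist y q = 1).card : ℝ)) := by
  refine sum_le_sum fun y _ => ?_
  have h := card_contacts_add_card_extContacts_le_twelve X V hsep hdisj y
  have h' : (((X.filter fun q => dist y q = 1).card : ℕ) : ℝ) + (((V.filter fun q => dist y q = 1).card : ℕ) : ℝ)
      ≤ 12 := by exact_mod_cast h
  linarith

/-- **The same count read from the sites** (double counting): `Σ_{y∈S} #{v ∈ V : dist y v = 1} = Σ_{v∈V} #{y ∈ S : dist v y = 1}`. -/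
theorem sum_extContacts_eq_sum_card_contacts (V S : Finset (EuclideanSpace ℝ (Fin 3))) :
    (∑ y ∈ S, (V.filter fun q => dist y q = 1).card) = ∑ v ∈ V, (S.filter fun y => dist v y = 1).card := by
  classical
  simp only [card_filter]
  rw [sum_comm]
  refine sum_congr rfl fun v _ => sum_congr rfl fun y _ => ?_
  rw [dist_comm]

/-- **Packing-extension credits, site form.**  With `S` finite (typically `S ⊆ X`) and `V` a packing extension of `X`:
`Σ_{v ∈ V} #{y ∈ S : dist v y = 1} ≤ Σ_{y ∈ S} (12 − deg_X y)` — every ball–site contact of an addable site is one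
certified missing contact of the ledger. -/
theorem sum_card_contacts_ext_le_sum_twelve_sub (X V S : Finset (EuclideanSpace ℝ (Fin 3)))
    (hsep : ∀ p ∈ X ∪ V, ∀ q ∈ X ∪ V, p ≠ q → 1 ≤ dist p q) (hdisj : Disjoint X V) :
    (∑ v ∈ V, ((S.filter fun y => dist v y = 1).card : ℝ)) ≤
      ∑ y ∈ S, ((12 : ℝ) - ((X.filter fun q => dist y q = 1).card : ℝ)) := by
  have h := sum_extContacts_le_sum_twelve_sub X V S hsep hdisj
  have e := sum_extContacts_eq_sum_card_contacts V S
  have e' : (∑ y ∈ S, ((V.filter fun q => dist y q = 1).card : ℝ)) =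
      ∑ v ∈ V, ((S.filter fun y => dist v y = 1).card : ℝ) := by exact_mod_cast congrArg (Nat.cast (R := ℝ)) e
  linarith

/-! ### One and two addable sites -/

/-- A `1`-separated `X` and a site `v` at distance `≥ 1` from every ball of `X`: `X ∪ {v}` is `1`-separated and
`v ∉ X`. -/
theorem sep_union_singleton_of_addable (X : Finset (EuclideanSpace ℝ (Fin 3)))
    (hX : ∀ p ∈ X, ∀ q ∈ X, p ≠ q → 1 ≤ dist p q) (v : EuclideanSpace ℝ (Fin 3)) (hv : ∀ q ∈ X, 1 ≤ dist v q) :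
    (∀ p ∈ X ∪ {v}, ∀ q ∈ X ∪ {v}, p ≠ q → 1 ≤ dist p q) ∧ Disjoint X {v} := by
  classical
  refine ⟨fun p hp q hq hpq => ?_, ?_⟩
  · rcases mem_union.1 hp with hp | hp <;> rcases mem_union.1 hq with hq | hq
    · exact hX p hp q hq hpq
    · rw [mem_singleton.1 hq, dist_comm]; exact hv p hp
    · rw [mem_singleton.1 hp]; exact hv q hq
    · exact absurd ((mem_singleton.1 hp).trans (mem_singleton.1 hq).symm) hpq
  · rw [disjoint_singleton_right]
    intro hvX
    have := hv v hvX
    rw [dist_self] at this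
    linarith

/-- **One addable site costs its contacts a contact.**  If the site `v` keeps distance `≥ 1` from every ball of the
`1`-separated `X`, then every ball `y ∈ X` touching `v` (`dist y v = 1`) has at most ELEVEN contacts in `X`. -/
theorem card_contacts_le_eleven_of_addable (X : Finset (EuclideanSpace ℝ (Fin 3)))
    (hX : ∀ p ∈ X, ∀ q ∈ X, p ≠ q → 1 ≤ dist p q) (v : EuclideanSpace ℝ (Fin 3)) (hv : ∀ q ∈ X, 1 ≤ dist v q)
    {y : EuclideanSpace ℝ (Fin 3)} (hyv : dist y v = 1) :
    (X.filter fun q => dist y q = 1).card ≤ 11 := by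
  classical
  obtain ⟨hsep, hdisj⟩ := sep_union_singleton_of_addable X hX v hv
  have h := card_contacts_add_card_extContacts_le_twelve X {v} hsep hdisj y
  have h1 : (({v} : Finset _).filter fun q => dist y q = 1).card = 1 := by
    rw [filter_singleton, if_pos hyv, card_singleton]
  omega

/-- **Two addable sites at mutual distance `≥ 1` cost a common contact two contacts.**  If `v`, `v'` keep distance
`≥ 1` from every ball of `X` and from each other, every `y ∈ X` touching both has at most TEN contacts in `X`. -/
theorem card_contacts_le_ten_of_two_addable (X : Finset (EuclideanSpace ℝ (Fin 3)))
    (hX : ∀ p ∈ X, ∀ q ∈ X, p ≠ q → 1 ≤ dist p q) (v v' : EuclideanSpace ℝ (Fin 3)) (hvv' : 1 ≤ dist v v')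
    (hv : ∀ q ∈ X, 1 ≤ dist v q) (hv' : ∀ q ∈ X, 1 ≤ dist v' q)
    {y : EuclideanSpace ℝ (Fin 3)} (hyv : dist y v = 1) (hyv' : dist y v' = 1) :
    (X.filter fun q => dist y q = 1).card ≤ 10 := by
  classical
  have hne : v ≠ v' := by
    intro h; rw [h, dist_self] at hvv'; linarith
  -- `X ∪ {v}` is separated and `v'` is addable to it
  obtain ⟨hsep₁, hdisj₁⟩ := sep_union_singleton_of_addable X hX v hv
  have hv'₁ : ∀ q ∈ X ∪ {v}, 1 ≤ dist v' q := by
    intro q hq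
    rcases mem_union.1 hq with hq | hq
    · exact hv' q hq
    · rw [mem_singleton.1 hq, dist_comm]; exact hvv'
  obtain ⟨hsep₂, hdisj₂⟩ := sep_union_singleton_of_addable (X ∪ {v}) hsep₁ v' hv'₁
  have h := card_contacts_add_card_extContacts_le_twelve (X ∪ {v}) {v'} hsep₂ hdisj₂ y
  rw [filter_union, card_union_of_disjoint (disjoint_filter_filter hdisj₁)] at h
  have h1 : (({v} : Finset _).filter fun q => dist y q = 1).card = 1 := by
    rw [filter_singleton, if_pos hyv, card_singleton]
  have h2 : (({v'} : Finset _).filter fun q => dist y q = 1).card = 1 := by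
    rw [filter_singleton, if_pos hyv', card_singleton]
  omega

end Summit.Ventures.Crystal3D.Theorems

end
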